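import Summits.Langlands.Langlands.Theorems.AbelianSurfaceSerreSerreGSp4SurjectiveSingerDefs
import Literature.NumberTheory.Automorphic.PDAutomorphyLiftingGL4Rational
import Literature.NumberTheory.Automorphic.AlgebraicityTwist
import Literature.NumberTheory.Automorphic.ArchParameterUnique
import HarnessLib

/-!
# Route `AbelianSurfaceSerre`, crux `SerreGSp4Surjective` (stmt-Langlands-17765), line
# `singer-type-evaporation`: stub 4/7 `stub_automorphyLifting` (skeleton v4) from the named fact
# `BLGGT2014_thm421_rat_GL4`

The line's Fontaine–Laffaille automorphy lifting step over `ℚ`, `n = 4`, in the v4 (registered) form: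
from `Literature.NumberTheory.Automorphic.BLGGT2014_thm421_rat_GL4` (Barnet-Lamb–Gee–Geraghty–Taylor
2014, Thm 4.2.1 over `ℚ`, `n = 4`, multiplier `ε_ℓ⁻¹`, Fontaine–Laffaille case; named fact, p155510),
an `ℓ`-adic `r'` (`ℓ ≥ 11`) which is irreducible, symplectic with multiplier `ε_ℓ⁻¹` (`cycInv ℓ`),
crystalline at `ℓ` with four distinct labelled Hodge–Tate weights `wts ⊂ [lo, hi]`, `hi - lo + 2 ≤ ℓ`,
unramified almost everywhere, reducing to `ρ'` ALONG a residue map `red : 𝒪_{ℚ̄_ℓ} → k̄`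
(`ReducesAlong`), with `ρ' ⊗ k̄` irreducible on `Γ_{ℚ(ζ_ℓ)}` (`IrredOnCycKernel`) and residually
automorphic ALONG THE SAME `red` from a regular algebraic cuspidal `π` on `GL₄(𝔸_ℚ)` unramified at `ℓ`
whose `ℓ`-adic `r₁` is symplectic-`ε⁻¹` and Fontaine–Laffaille crystalline (`ResiduallyAutomorphicAlong`),
is automorphic (`AutomorphicAE`, the crux's `m = 4` normalisation).

Why the residue map is SHARED (skeleton v4, reshape R3): with two independent residue maps the
hypotheses give only `r̄'^ss ≅ ^φ r̄₁^ss` up to a Frobenius twist `φ ∈ Gal(k̄/𝔽_ℓ)`, which is not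
BLGGT's residual hypothesis for the given `(π, ı)`.

Contents (everything proved; two definitions are line vocabulary consumed by the registered stubs 3, 4, 5):
* `ReducesAlong ℓ red r ρ'` (body of the crux device `ReducesTo` with `red` exposed;
  `reducesTo_iff_exists_reducesAlong` is `Iff.rfl`), `ResiduallyAutomorphicAlong ℓ red ρ'`
  (`ResiduallyAutomorphic` with its source reducing along the given `red`), and the auxiliary
  `ResiduallyAutomorphicLift ℓ r` (congruence form, `FramedRep.IsResiduallyCongruent r r₁`);
* glue `isResiduallyCongruent_of_reducesAlong` (two representations reducing to the same `ρ'` along the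
  same `red` are residually congruent: the difference of their integral characteristic polynomials lies
  in `ker red ⊆ 𝔪 = {‖x‖ < 1}`), `residuallyAutomorphicLift_of_along`;
* normalisation bridges `exists_isLAlgebraic_twist` / `automorphicAE_of_isLAlgebraic` (regular
  algebraic with `arithFrobPolyOfSatake ι q 4` ⇄ L-algebraic with regular infinity type and
  `arithFrobPolyOfSatake ι q 1`, by the twist `|det|^{∓3/2}`; `(√q)³ = q^{3/2}`);
* `automorphicAE_of_BLGGT421` (congruence form), `automorphicAE_of_BLGGT421_along` (shared-`red` form),
  and the REGISTERED `stub_automorphyLifting` (the named fact as its first hypothesis).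

References: BarnetlambEtAl2014 Thm 4.2.1, Lemma 1.4.3 (2), §2.1; BuzzardGeeLMS2014 §2.1 and Conj. 3.2.1
(L-normalisation); HarrisLanTaylorThorneRMS2016 Thm A (`m = n` normalisation).
-/

set_option linter.dupNamespace false

namespace Summit.Langlands.Langlands.Cruxes.SerreGSp4Surjective.SingerTypeEvaporation

open Literature.NumberTheory.GaloisRepresentations Literature.NumberTheory.Automorphic
  Literature.NumberTheory.PAdicHodge
open scoped NumberField
open IsDedekindDomain Polynomial Filter

noncomputable section

/-! ## The corrected residual hypothesis -/

/-- **Residually automorphic lift (corrected form of the stub's residual hypothesis).**  The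
`ℓ`-adic `r : Γ_ℚ → GL₄(ℚ̄_ℓ)` is congruent modulo `𝔪_{ℚ̄_ℓ}` (accepted
`FramedRep.IsResiduallyCongruent`: coefficientwise congruence of characteristic polynomials, i.e.
`r̄^{ss} ≅ r̄₁^{ss}`) to an `r₁` which is symplectic with multiplier `ε_ℓ⁻¹`, crystalline at `ℓ` with
Hodge–Tate weights in an interval of length `≤ ℓ - 2` (Fontaine–Laffaille), and attached a.e.
(HLTT normalisation `m = 4`) through some `ι` to a regular algebraic cuspidal `π` on `GL₄(𝔸_ℚ)`
unramified at `ℓ`.  This is `ResiduallyAutomorphic ℓ ρ'` with its last clause `ReducesTo ℓ r₁ ρ'`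
(a second, independent residue map) replaced by the congruence with `r` itself — exactly BLGGT
Thm 4.2.1's "`(r̄, μ̄) ≅ (r̄_{l,ı}(π), r̄_{l,ı}(χ) ε̄_l^{1-n})`" with `π` of level prime to `l` and
`r_{l,ı}(π)` Fontaine–Laffaille. [cite: BarnetlambEtAl2014, Thm. 4.2.1] -/
def ResiduallyAutomorphicLift (ℓ : ℕ) [Fact ℓ.Prime] (r : FramedGaloisRep ℚ (PadicAlgCl ℓ) 4) :
    Prop :=
  ∃ (hcpt : isCompact_glFiniteIntegralLevel 4 ℚ) (π : CuspidalAutomorphicRepData 4 ℚ hcpt)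
    (ι : PadicAlgCl ℓ ≃+* ℂ) (r₁ : FramedGaloisRep ℚ (PadicAlgCl ℓ) 4),
    π.1.IsRegularAlgebraic ∧ r₁.IsSymplecticWithMultiplierFun (cycInv ℓ) ∧
    (∀ (v : HeightOneSpectrum (𝓞 ℚ)) (hv : ((ℓ : ℕ) : 𝓞 ℚ) ∈ v.asIdeal),
      π.1.IsUnramifiedAt v ∧ (fontainePstAdicCompletion v ℓ hv).IsCrystallineFramed (r₁.toLocal v) ∧
        ∃ a b : ℤ, b - a + 2 ≤ (ℓ : ℤ) ∧
          (fontainePstAdicCompletion v ℓ hv).IsDeRhamWithWeightsIn a b (r₁.toLocal v)) ∧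
    (∀ᶠ v : HeightOneSpectrum (𝓞 ℚ) in Filter.cofinite, ∃ s : Multiset ℂ,
      π.1.HasSatakeParamAt v s ∧ r₁.IsUnramifiedAt v ∧
        r₁.HasFrobCharpolyAt v (arithFrobPolyOfSatake ι v.residueCard 4 s)) ∧
    FramedRep.IsResiduallyCongruent r r₁

/-! ## The Serre-like alternative: one SHARED residue map (`ReducesAlong`, `ResiduallyAutomorphicAlong`)

The other minimal reshape: keep `ρ'` in the residual hypothesis but quantify its residue map once.
`ReducesTo ℓ r ρ' ↔ ∃ red, ReducesAlong ℓ red r ρ'` (`Iff.rfl`), and a source reducing to `ρ'`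
along the SAME `red` as `r'` is residually congruent to `r'` (`isResiduallyCongruent_of_reducesAlong`,
PROVED: the difference of the integral characteristic polynomials lies in `ker red ⊆ 𝔪 = {‖x‖ < 1}`),
so this form implies `ResiduallyAutomorphicLift` (`residuallyAutomorphicLift_of_along`). -/

/-- `r` REDUCES TO `ρ'` ALONG THE GIVEN `red : 𝒪_{ℚ̄_ℓ} → k̄`: the body of `ReducesTo` with the
residue map exposed. [folklore] -/
def ReducesAlong (ℓ : ℕ) [Fact ℓ.Prime] {k : Type} [Field k] [TopologicalSpace k]
    (red : (Valued.v : Valuation (PadicAlgCl ℓ) NNReal).valuationSubring →+* AlgebraicClosure k)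
    (r : FramedGaloisRep ℚ (PadicAlgCl ℓ) 4) (ρ' : FramedGaloisRep ℚ k 4) : Prop :=
  ∀ g : Field.absoluteGaloisGroup ℚ,
    ∃ P : Polynomial (Valued.v : Valuation (PadicAlgCl ℓ) NNReal).valuationSubring,
      P.map (Valued.v : Valuation (PadicAlgCl ℓ) NNReal).valuationSubring.subtype =
          FramedRep.charpoly r g ∧
        P.map red = (FramedRep.charpoly ρ' g).map (algebraMap k (AlgebraicClosure k))

/-- `ReducesTo` is `ReducesAlong` with the residue map hidden (definitional). [folklore] -/
theorem reducesTo_iff_exists_reducesAlong (ℓ : ℕ) [Fact ℓ.Prime] {k : Type} [Field k]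
    [TopologicalSpace k] (r : FramedGaloisRep ℚ (PadicAlgCl ℓ) 4) (ρ' : FramedGaloisRep ℚ k 4) :
    ReducesTo ℓ r ρ' ↔ ∃ red, ReducesAlong ℓ red r ρ' :=
  Iff.rfl

/-- **Residual automorphy of `ρ'` ALONG `red`**: the body of `ResiduallyAutomorphic ℓ ρ'` with its
last clause `ReducesTo ℓ r₁ ρ'` sharpened to `ReducesAlong ℓ red r₁ ρ'` for the GIVEN residue map.
[cite: BarnetlambEtAl2014, Thm. 4.2.1] -/
def ResiduallyAutomorphicAlong (ℓ : ℕ) [Fact ℓ.Prime] {k : Type} [Field k] [TopologicalSpace k]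
    (red : (Valued.v : Valuation (PadicAlgCl ℓ) NNReal).valuationSubring →+* AlgebraicClosure k)
    (ρ' : FramedGaloisRep ℚ k 4) : Prop :=
  ∃ (hcpt : isCompact_glFiniteIntegralLevel 4 ℚ) (π : CuspidalAutomorphicRepData 4 ℚ hcpt)
    (ι : PadicAlgCl ℓ ≃+* ℂ) (r₁ : FramedGaloisRep ℚ (PadicAlgCl ℓ) 4),
    π.1.IsRegularAlgebraic ∧ r₁.IsSymplecticWithMultiplierFun (cycInv ℓ) ∧
    (∀ (v : HeightOneSpectrum (𝓞 ℚ)) (hv : ((ℓ : ℕ) : 𝓞 ℚ) ∈ v.asIdeal),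
      π.1.IsUnramifiedAt v ∧ (fontainePstAdicCompletion v ℓ hv).IsCrystallineFramed (r₁.toLocal v) ∧
        ∃ a b : ℤ, b - a + 2 ≤ (ℓ : ℤ) ∧
          (fontainePstAdicCompletion v ℓ hv).IsDeRhamWithWeightsIn a b (r₁.toLocal v)) ∧
    (∀ᶠ v : HeightOneSpectrum (𝓞 ℚ) in Filter.cofinite, ∃ s : Multiset ℂ,
      π.1.HasSatakeParamAt v s ∧ r₁.IsUnramifiedAt v ∧
        r₁.HasFrobCharpolyAt v (arithFrobPolyOfSatake ι v.residueCard 4 s)) ∧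
    ReducesAlong ℓ red r₁ ρ'

/-- The sharpened residual automorphy forgets to the registered one. [folklore] -/
theorem ResiduallyAutomorphicAlong.residuallyAutomorphic {ℓ : ℕ} [Fact ℓ.Prime] {k : Type}
    [Field k] [TopologicalSpace k]
    {red : (Valued.v : Valuation (PadicAlgCl ℓ) NNReal).valuationSubring →+* AlgebraicClosure k}
    {ρ' : FramedGaloisRep ℚ k 4} (h : ResiduallyAutomorphicAlong ℓ red ρ') :
    ResiduallyAutomorphic ℓ ρ' := by
  obtain ⟨hcpt, π, ι, r₁, h1, h2, h3, h4, h5⟩ := h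
  exact ⟨hcpt, π, ι, r₁, h1, h2, h3, h4, red, h5⟩

/-- **Two `ℓ`-adic representations reducing to the same `ρ'` along the SAME residue map are
residually congruent** (`FramedRep.IsResiduallyCongruent`): coefficientwise, the integral lifts
`P, P₁` of the characteristic polynomials have `red (P - P₁) = 0`, so `P - P₁` has non-unit
coefficients in the valuation ring `𝒪_{ℚ̄_ℓ} = {‖x‖ ≤ 1}`, i.e. coefficients of norm `< 1`
(`mem_maximalIdeal_iff_norm_lt_one`). [folklore] -/
theorem isResiduallyCongruent_of_reducesAlong {ℓ : ℕ} [Fact ℓ.Prime] {k : Type} [Field k]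
    [TopologicalSpace k]
    {red : (Valued.v : Valuation (PadicAlgCl ℓ) NNReal).valuationSubring →+* AlgebraicClosure k}
    {r r₁ : FramedGaloisRep ℚ (PadicAlgCl ℓ) 4} {ρ' : FramedGaloisRep ℚ k 4}
    (h : ReducesAlong ℓ red r ρ') (h₁ : ReducesAlong ℓ red r₁ ρ') :
    FramedRep.IsResiduallyCongruent r r₁ := by
  rw [FramedRep.isResiduallyCongruent_iff]
  intro σ i
  obtain ⟨P, hP, hPred⟩ := h σ
  obtain ⟨P₁, hP₁, hP₁red⟩ := h₁ σ
  have hc : (FramedRep.charpoly r σ).coeff i =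
      ((P.coeff i : (Valued.v : Valuation (PadicAlgCl ℓ) NNReal).valuationSubring) : PadicAlgCl ℓ) := by
    rw [← hP, Polynomial.coeff_map]; rfl
  have hc₁ : (FramedRep.charpoly r₁ σ).coeff i =
      ((P₁.coeff i : (Valued.v : Valuation (PadicAlgCl ℓ) NNReal).valuationSubring) : PadicAlgCl ℓ) := by
    rw [← hP₁, Polynomial.coeff_map]; rfl
  have hdiff : red (P.coeff i - P₁.coeff i) = 0 := by
    rw [map_sub, ← Polynomial.coeff_map, ← Polynomial.coeff_map, hPred, hP₁red, sub_self]
  have hnu : ¬ IsUnit (P.coeff i - P₁.coeff i) := fun hu => (hu.map red).ne_zero hdiff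
  have hmem : P.coeff i - P₁.coeff i ∈
      IsLocalRing.maximalIdeal (Valued.v : Valuation (PadicAlgCl ℓ) NNReal).valuationSubring :=
    (IsLocalRing.mem_maximalIdeal _).mpr hnu
  have hlt := (mem_maximalIdeal_iff_norm_lt_one (padicAlgCl_mem_valuationSubring_iff ℓ) _).mp hmem
  rw [hc, hc₁]
  simpa using hlt

/-- The Serre-like reshape implies the congruence reshape: a source reducing to `ρ'` along the same
`red` as `r'` witnesses `ResiduallyAutomorphicLift ℓ r'`. [folklore] -/
theorem residuallyAutomorphicLift_of_along {ℓ : ℕ} [Fact ℓ.Prime] {k : Type} [Field k]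
    [TopologicalSpace k]
    {red : (Valued.v : Valuation (PadicAlgCl ℓ) NNReal).valuationSubring →+* AlgebraicClosure k}
    {r' : FramedGaloisRep ℚ (PadicAlgCl ℓ) 4} {ρ' : FramedGaloisRep ℚ k 4}
    (hred : ReducesAlong ℓ red r' ρ') (hra : ResiduallyAutomorphicAlong ℓ red ρ') :
    ResiduallyAutomorphicLift ℓ r' := by
  obtain ⟨hcpt, π, ι, r₁, h1, h2, h3, h4, h5⟩ := hra
  exact ⟨hcpt, π, ι, r₁, h1, h2, h3, h4, isResiduallyCongruent_of_reducesAlong hred h5⟩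

/-! ## Normalisations: `(√q)³ = q^{3/2}` and the two Frobenius-polynomial identities -/

/-- `(√q)^{4-1} = q^{3/2}` in `ℂ`. [folklore] -/
theorem sqrt_pow_three_eq_cpow (q : ℕ) :
    (((Real.sqrt q : ℝ)) : ℂ) ^ (4 - 1) = ((q : ℂ)) ^ (((3 / 2 : ℝ)) : ℂ) := by
  rw [show (4 - 1 : ℕ) = 3 from rfl, ← Complex.ofReal_natCast q,
    ← Complex.ofReal_cpow (Nat.cast_nonneg q), ← Complex.ofReal_pow]
  congr 1
  rw [Real.sqrt_eq_rpow, ← Real.rpow_natCast, ← Real.rpow_mul (Nat.cast_nonneg q)]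
  norm_num

/-- **`m = 4` for `α` is `m = 1` for `q^{3/2} α`**: the Satake parameter of `π ⊗ |det|^{-3/2}` in
Buzzard–Gee's `L`-normalisation predicts the same Frobenius polynomial as that of the regular
algebraic `π` in the Harris–Lan–Taylor–Thorne normalisation. [folklore] -/
theorem arithFrobPolyOfSatake_one_twist {ℓ : ℕ} [Fact ℓ.Prime] (ι : PadicAlgCl ℓ ≃+* ℂ) (q : ℕ)
    (α : Multiset ℂ) :
    arithFrobPolyOfSatake ι q 1 (α.map (((q : ℂ) ^ (-(((-(3 / 2 : ℝ)) : ℝ) : ℂ))) * ·)) =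
      arithFrobPolyOfSatake ι q 4 α := by
  simp only [arithFrobPolyOfSatake, Multiset.map_map, Function.comp_def]
  congr 1
  refine Multiset.map_congr rfl fun a _ => ?_
  rw [show (1 - 1 : ℕ) = 0 from rfl, pow_zero, one_mul, Complex.ofReal_neg, neg_neg,
    sqrt_pow_three_eq_cpow]

/-- **`m = 1` for `α` is `m = 4` for `q^{-3/2} α`**: conversely for the twist `π ⊗ |det|^{3/2}` of an
`L`-algebraic `π`. [folklore] -/
theorem arithFrobPolyOfSatake_four_twist {ℓ : ℕ} [Fact ℓ.Prime] (ι : PadicAlgCl ℓ ≃+* ℂ) {q : ℕ}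
    (hq : 0 < q) (α : Multiset ℂ) :
    arithFrobPolyOfSatake ι q 4 (α.map (((q : ℂ) ^ (-(((3 / 2 : ℝ) : ℝ) : ℂ))) * ·)) =
      arithFrobPolyOfSatake ι q 1 α := by
  simp only [arithFrobPolyOfSatake, Multiset.map_map, Function.comp_def]
  congr 1
  refine Multiset.map_congr rfl fun a _ => ?_
  have hq' : ((q : ℂ)) ^ (((3 / 2 : ℝ)) : ℂ) ≠ 0 := fun h => by
    rw [Complex.cpow_eq_zero_iff] at h
    exact (Nat.cast_ne_zero.mpr hq.ne') h.1
  rw [show (1 - 1 : ℕ) = 0 from rfl, pow_zero, one_mul, sqrt_pow_three_eq_cpow, Complex.cpow_neg,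
    ← mul_assoc, mul_inv_cancel₀ hq', one_mul]

/-! ## Regular algebraic (`m = 4`) ⇄ `L`-algebraic with regular type (`m = 1`) -/

/-- **From the line's normalisation to the fact's.**  A regular algebraic cuspidal `π` on
`GL₄(𝔸_ℚ)` to which `r` is attached a.e. in the HLTT normalisation (`m = 4`) has the cuspidal twist
`π' = π ⊗ |det|^{-3/2}`, `L`-algebraic with a regular infinity type, with `r` attached a.e. in
Buzzard–Gee's normalisation (`SatakeFrobCompatibleAE ι π'.1 r`), unramified wherever `π` is.
[cite: BuzzardGeeLMS2014, §5.3] -/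
theorem exists_isLAlgebraic_twist {ℓ : ℕ} [Fact ℓ.Prime] {hcpt : isCompact_glFiniteIntegralLevel 4 ℚ}
    (π : CuspidalAutomorphicRepData 4 ℚ hcpt) (hRA : π.1.IsRegularAlgebraic)
    (ι : PadicAlgCl ℓ ≃+* ℂ) (r : FramedGaloisRep ℚ (PadicAlgCl ℓ) 4)
    (hsat : ∀ᶠ v : HeightOneSpectrum (𝓞 ℚ) in Filter.cofinite, ∃ s : Multiset ℂ,
      π.1.HasSatakeParamAt v s ∧ r.IsUnramifiedAt v ∧
        r.HasFrobCharpolyAt v (arithFrobPolyOfSatake ι v.residueCard 4 s)) :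
    ∃ π' : CuspidalAutomorphicRepData 4 ℚ hcpt, π'.1.IsLAlgebraic ∧
      (∃ T : InfinityType ℚ 4, π'.1.HasInfinityType T ∧ T.IsRegular) ∧
      SatakeFrobCompatibleAE ι π'.1 r ∧
      ∀ v : HeightOneSpectrum (𝓞 ℚ), π.1.IsUnramifiedAt v → π'.1.IsUnramifiedAt v := by
  haveI : NeZero (4 : ℕ) := ⟨by norm_num⟩
  obtain ⟨T, hT, hC, hreg⟩ := hRA
  obtain ⟨χ, π', hχ, hW, hW', hT'⟩ := π.exists_twist_hasInfinityType (-(3 / 2 : ℝ)) hT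
  refine ⟨π', ⟨_, hT', ?_⟩, ⟨_, hT', hreg.twist _⟩, ?_, fun v hv => ?_⟩
  · have h1 := ((InfinityType.isCAlgebraic_iff_isLAlgebraic_twist T).mp hC).twist_intCast (-3)
    rw [InfinityType.twist_twist] at h1
    convert h1 using 2
    push_cast
    ring
  · filter_upwards [hsat] with v ⟨s, hs, hur, hP⟩
    refine ⟨_, hs.of_map_mulChar_detTwist_of_cpow hχ hW hW', hur, ?_⟩
    rwa [arithFrobPolyOfSatake_one_twist]
  · obtain ⟨α, hα⟩ := hv
    exact ⟨_, hα.of_map_mulChar_detTwist_of_cpow hχ hW hW'⟩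

/-- **From the fact's normalisation back to the line's.**  If a cuspidal `π` on `GL₄(𝔸_ℚ)` is
`L`-algebraic with a regular infinity type and `r` is attached to `(π, ι)` a.e. in Buzzard–Gee's
normalisation, then `r` is automorphic in the line's sense `AutomorphicAE ℓ r`: the twist
`π ⊗ |det|^{3/2}` is regular algebraic (Clozel) and `r` is attached to it in the HLTT normalisation
`m = 4` (regularity passes between infinity types of the same `π`, `HasInfinityType.map_a_eq`).
[cite: BuzzardGeeLMS2014, §5.3] -/
theorem automorphicAE_of_isLAlgebraic {ℓ : ℕ} [Fact ℓ.Prime]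
    {hcpt : isCompact_glFiniteIntegralLevel 4 ℚ} (ι : PadicAlgCl ℓ ≃+* ℂ)
    (r : FramedGaloisRep ℚ (PadicAlgCl ℓ) 4) (π : CuspidalAutomorphicRepData 4 ℚ hcpt)
    (hL : π.1.IsLAlgebraic) (hreg : ∃ T : InfinityType ℚ 4, π.1.HasInfinityType T ∧ T.IsRegular)
    (hsat : SatakeFrobCompatibleAE ι π.1 r) : AutomorphicAE ℓ r := by
  haveI : NeZero (4 : ℕ) := ⟨by norm_num⟩
  obtain ⟨T, hT, hTL⟩ := hL
  obtain ⟨T', hT', hreg'⟩ := hreg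
  have hTreg : T.IsRegular := fun σ => by
    rw [AutomorphicRepData.HasInfinityType.map_a_eq π.1 hT hT' σ]
    exact hreg' σ
  obtain ⟨χ, π₃, hχ, hW, hW', hT₃⟩ := π.exists_twist_hasInfinityType (3 / 2 : ℝ) hT
  refine ⟨hcpt, π₃, ι, ⟨_, hT₃, ?_, hTreg.twist _⟩, ?_⟩
  · rw [InfinityType.isCAlgebraic_iff_isLAlgebraic_twist, InfinityType.twist_twist]
    convert hTL.twist_intCast 3 using 2
    push_cast
    ring
  · filter_upwards [hsat] with v ⟨α, hα, hur, hP⟩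
    refine ⟨_, hα.of_map_mulChar_detTwist_of_cpow hχ hW hW', hur, ?_⟩
    rwa [arithFrobPolyOfSatake_four_twist ι (zero_lt_one.trans v.one_lt_residueCard)]

/-! ## The stub, corrected form, from the named fact -/

/-- **`stub_automorphyLifting` in corrected form, conditional on the named fact
`BLGGT2014_thm421_rat_GL4` only.**  Differences from the registered signature: (M1) the residual
hypothesis is `ResiduallyAutomorphicLift ℓ r'` (congruence of `r'` with the source `r₁` in
`𝒪_{ℚ̄_ℓ}`) instead of `ResiduallyAutomorphic ℓ ρ'` (an independent residue map); (M2)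
`Multiset.card wts = 4`; (M3) `r'.toGaloisRep.IsIrreducible`.  Proof: unfold, move the source to
Buzzard–Gee's normalisation (`exists_isLAlgebraic_twist`), feed the fact, move the conclusion back
(`automorphicAE_of_isLAlgebraic`). [cite: BarnetlambEtAl2014, Thm. 4.2.1] -/
theorem automorphicAE_of_BLGGT421 (h : BLGGT2014_thm421_rat_GL4) :
    ∀ (ℓ : ℕ) [Fact ℓ.Prime], 11 ≤ ℓ → ∀ (wts : Multiset ℤ) (lo hi : ℤ)
      (r' : FramedGaloisRep ℚ (PadicAlgCl ℓ) 4)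
      (k : Type) [Field k] [Fintype k] [CharP k ℓ] [TopologicalSpace k] [DiscreteTopology k]
      (ρ' : FramedGaloisRep ℚ k 4),
      wts.Nodup → Multiset.card wts = 4 → (∀ x ∈ wts, lo ≤ x ∧ x ≤ hi) → hi - lo + 2 ≤ (ℓ : ℤ) →
        r'.toGaloisRep.IsIrreducible →
        r'.IsSymplecticWithMultiplierFun (cycInv ℓ) → IsCrystallineWithWeightsAt ℓ wts r' →
          (∀ᶠ v : HeightOneSpectrum (𝓞 ℚ) in Filter.cofinite, r'.IsUnramifiedAt v) →
            ReducesTo ℓ r' ρ' → IrredOnCycKernel ℓ ρ' → ResiduallyAutomorphicLift ℓ r' →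
              AutomorphicAE ℓ r' := by
  intro ℓ _ h11 wts lo hi r' k _ _ _ _ _ ρ' hnd hcard hrange hℓ hirr hsymp hcrys hunr hred hbig hra
  obtain ⟨hcpt, π, ι, r₁, hRA, hsymp₁, hloc, hsat, hcong⟩ := hra
  obtain ⟨red, hred⟩ := hred
  -- the source, in Buzzard–Gee's normalisation
  obtain ⟨π₀, hL₀, hreg₀, hsat₀, hunr₀⟩ := exists_isLAlgebraic_twist π hRA ι r₁ hsat
  -- the Fontaine–Laffaille clause of the fact
  have hFL : ∀ (v : HeightOneSpectrum (𝓞 ℚ)) (hv : ((ℓ : ℕ) : 𝓞 ℚ) ∈ v.asIdeal),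
      let D := fontainePstAdicCompletion v ℓ hv
      D.IsCrystallineFramed (r'.toLocal v) ∧
      (letI := D.algebra
       ∀ τ : v.adicCompletion ℚ →ₐ[ℚ_[ℓ]] PadicAlgCl ℓ,
        let M := r'.labelledHodgeTateWeightsAt v D.algebra D.𝔅 τ.toRingHom
        M.Nodup ∧ Multiset.card M = 4 ∧ ∃ a : ℤ, ∀ x ∈ M, a ≤ x ∧ x ≤ a + ((ℓ : ℤ) - 2)) := by
    intro v hv
    refine ⟨(hcrys v hv).1, fun τ => ?_⟩
    have hM := (hcrys v hv).2 τ
    dsimp only at hM ⊢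
    rw [hM]
    exact ⟨hnd, hcard, lo, fun x hx => ⟨(hrange x hx).1, by have := (hrange x hx).2; omega⟩⟩
  -- the residual-automorphy clause of the fact
  have hmod : ∃ (π₀ : CuspidalAutomorphicRepData 4 ℚ hcpt) (ρ₀ : FramedGaloisRep ℚ (PadicAlgCl ℓ) 4),
      π₀.1.IsLAlgebraic ∧ (∃ T : InfinityType ℚ 4, π₀.1.HasInfinityType T ∧ T.IsRegular) ∧
      SatakeFrobCompatibleAE ι π₀.1 ρ₀ ∧ FramedRep.IsResiduallyCongruent r' ρ₀ ∧
      ρ₀.IsSymplecticWithMultiplierFun (fun g => algebraMap ℚ_[ℓ] (PadicAlgCl ℓ)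
        ((((GaloisRep.cyclotomicCharacter ℚ ℓ g)⁻¹ : ℤ_[ℓ]ˣ) : ℤ_[ℓ]) : ℚ_[ℓ])) ∧
      (∀ v : HeightOneSpectrum (𝓞 ℚ), ((ℓ : ℕ) : 𝓞 ℚ) ∈ v.asIdeal → π₀.1.IsUnramifiedAt v) ∧
      ∀ (v : HeightOneSpectrum (𝓞 ℚ)) (hv : ((ℓ : ℕ) : 𝓞 ℚ) ∈ v.asIdeal),
        (fontainePstAdicCompletion v ℓ hv).IsCrystallineFramed (ρ₀.toLocal v) ∧
        ∃ a b : ℤ, b ≤ a + ((ℓ : ℤ) - 2) ∧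
          (fontainePstAdicCompletion v ℓ hv).IsDeRhamWithWeightsIn a b (ρ₀.toLocal v) := by
    refine ⟨π₀, r₁, hL₀, hreg₀, hsat₀, hcong, hsymp₁, fun v hv => hunr₀ v (hloc v hv).1,
      fun v hv => ⟨(hloc v hv).2.1, ?_⟩⟩
    obtain ⟨a, b, hab, hdr⟩ := (hloc v hv).2.2
    exact ⟨a, b, by omega, hdr⟩
  obtain ⟨π₂, hL₂, hreg₂, hsat₂⟩ := h ℓ h11 hcpt ι r' hirr hunr hsymp hFL k ρ' red hred hbig hmod
  exact automorphicAE_of_isLAlgebraic ι r' π₂ hL₂ hreg₂ hsat₂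

/-- **The same, in the Serre-like reshape** (one residue map `red` shared by `ReducesAlong ℓ red r' ρ'`
and `ResiduallyAutomorphicAlong ℓ red ρ'`). [cite: BarnetlambEtAl2014, Thm. 4.2.1] -/
theorem automorphicAE_of_BLGGT421_along (h : BLGGT2014_thm421_rat_GL4) :
    ∀ (ℓ : ℕ) [Fact ℓ.Prime], 11 ≤ ℓ → ∀ (wts : Multiset ℤ) (lo hi : ℤ)
      (r' : FramedGaloisRep ℚ (PadicAlgCl ℓ) 4)
      (k : Type) [Field k] [Fintype k] [CharP k ℓ] [TopologicalSpace k] [DiscreteTopology k]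
      (ρ' : FramedGaloisRep ℚ k 4)
      (red : (Valued.v : Valuation (PadicAlgCl ℓ) NNReal).valuationSubring →+* AlgebraicClosure k),
      wts.Nodup → Multiset.card wts = 4 → (∀ x ∈ wts, lo ≤ x ∧ x ≤ hi) → hi - lo + 2 ≤ (ℓ : ℤ) →
        r'.toGaloisRep.IsIrreducible →
        r'.IsSymplecticWithMultiplierFun (cycInv ℓ) → IsCrystallineWithWeightsAt ℓ wts r' →
          (∀ᶠ v : HeightOneSpectrum (𝓞 ℚ) in Filter.cofinite, r'.IsUnramifiedAt v) →
            ReducesAlong ℓ red r' ρ' → IrredOnCycKernel ℓ ρ' → ResiduallyAutomorphicAlong ℓ red ρ' →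
              AutomorphicAE ℓ r' := by
  intro ℓ _ h11 wts lo hi r' k _ _ _ _ _ ρ' red hnd hcard hrange hℓ hirr hsymp hcrys hunr hred hbig hra
  exact automorphicAE_of_BLGGT421 h ℓ h11 wts lo hi r' k ρ' hnd hcard hrange hℓ hirr hsymp hcrys hunr
    ⟨red, hred⟩ hbig (residuallyAutomorphicLift_of_along hred hra)

/-! ## The registered stub (skeleton v4) -/

/-- **Stub 4/7 `stub_automorphyLifting` (registered signature, verbatim; skeleton v4).**  The named fact
`BLGGT2014_thm421_rat_GL4` implies the line's Fontaine–Laffaille lifting statement in the shared-residue-map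
form.  Pure repackaging of `automorphicAE_of_BLGGT421_along`. [cite: BarnetlambEtAl2014, Thm. 4.2.1] -/
theorem stub_automorphyLifting :
    BLGGT2014_thm421_rat_GL4 →
    ∀ (ℓ : ℕ) [Fact ℓ.Prime], 11 ≤ ℓ → ∀ (wts : Multiset ℤ) (lo hi : ℤ)
      (r' : FramedGaloisRep ℚ (PadicAlgCl ℓ) 4)
      (k : Type) [Field k] [Fintype k] [CharP k ℓ] [TopologicalSpace k] [DiscreteTopology k]
      (ρ' : FramedGaloisRep ℚ k 4)
      (red : (Valued.v : Valuation (PadicAlgCl ℓ) NNReal).valuationSubring →+* AlgebraicClosure k),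
      wts.Nodup → Multiset.card wts = 4 → (∀ x ∈ wts, lo ≤ x ∧ x ≤ hi) → hi - lo + 2 ≤ (ℓ : ℤ) →
        r'.toGaloisRep.IsIrreducible →
        r'.IsSymplecticWithMultiplierFun (cycInv ℓ) → IsCrystallineWithWeightsAt ℓ wts r' →
          (∀ᶠ v : HeightOneSpectrum (𝓞 ℚ) in Filter.cofinite, r'.IsUnramifiedAt v) →
            ReducesAlong ℓ red r' ρ' → IrredOnCycKernel ℓ ρ' → ResiduallyAutomorphicAlong ℓ red ρ' →
              AutomorphicAE ℓ r' :=
  fun h => automorphicAE_of_BLGGT421_along h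

end

end Summit.Langlands.Langlands.Cruxes.SerreGSp4Surjective.SingerTypeEvaporation
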